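import Literature.AlgebraicGeometry.Modules.DetClassTensor
import Literature.AlgebraicGeometry.Modules.PullbackFrame
import Literature.AlgebraicGeometry.Modules.PullbackPushforwardTwist
import HarnessLib

/-!
# Pull-back and tensor product: `f^*(M ⊗ N) ⟶ f^*M ⊗ f^*N`, an isomorphism for vector bundles

The Stacks Project, Tag 01CA (Modules, §17.16), Lemma 17.16.4, verbatim: "Let `f : X → Y` be a
morphism of ringed spaces. Let `𝓕`, `𝓖` be `𝒪_Y`-modules. Then
`f^*(𝓕 ⊗_{𝒪_Y} 𝓖) = f^*𝓕 ⊗_{𝒪_X} f^*𝓖` functorially in `𝓕`, `𝓖`." Görtz–Wedhorn I, (7.8.2) p. 182: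
the canonical homomorphism `f^*(𝓕 ⊗ 𝓖) → f^*𝓕 ⊗ f^*𝓖` "is an isomorphism".

For a morphism of schemes `f : X ⟶ Y`, Mathlib's pull-back `Scheme.Modules.pullback f = f^*` is
ABSTRACT (a left adjoint of `f_*`, no sectionwise formula) and the tree's tensor product
`Modules.tensorObj M N` (`Modules/TensorProduct`) is the sheafification of the presheaf
`U ↦ M(U) ⊗_{𝒪(U)} N(U)`; no monoidal structure on `f^*` exists in Mathlib (pin) or in the tree
(`Modules/BoxTensor`: "NOT HERE: `p^*(M ⊗ N) ≅ p^*M ⊗ p^*N`"). This file constructs the comparison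
from the two adjunctions and proves it is an isomorphism when `M`, `N` are finite locally free:

* §1 elementary tensors `tmulSection P Q U s t = s ⊗ t ∈ Γ(P ⊗ Q, U)` (image of `s ⊗ₜ t` under the
  sheafification unit, the tree's `tensorUnitHom`), bilinear, compatible with restriction
  (`val_map_tmulSection`, `res_tmulSection`) and with `tensorMap` (`tensorMap_app_tmulSection`:
  `(φ ⊗ ψ)(s ⊗ t) = φ(s) ⊗ ψ(t)`);
* §2 **the lax structure of the direct image** `pushforwardTensorHom f P Q : f_*P ⊗ f_*Q ⟶ f_*(P ⊗ Q)`
  (sheafification-transpose of `P(f⁻¹V) ⊗_{𝒪_Y(V)} Q(f⁻¹V) → (P ⊗ Q)(f⁻¹V)`, `s ⊗ₜ t ↦ s ⊗ t`), its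
  value `μ(s ⊗ t) = s ⊗ t` (`pushforwardTensorHom_app_tmulSection`) and NATURALITY in `P`, `Q`
  (`pushforwardTensorHom_naturality`);
* §3 **the comparison** `pullbackTensorHom f M N : f^*(M ⊗ N) ⟶ f^*M ⊗ f^*N` — the transpose across
  `f^* ⊣ f_*` of `M ⊗ N ⟶ f_*(f^*M ⊗ f^*N)`, `m ⊗ n ↦ η(m) ⊗ η(n)` (`η_M ⊗ η_N` followed by the lax
  structure) — NATURAL in both variables (`pullbackTensorHom_naturality(_left/_right)`);
* §4 its VALUE ON PULLED-BACK SECTIONS **`θ(η(m ⊗ n)) = η(m) ⊗ η(n)`** (`pullbackTensorHom_app_unitSection`,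
  with `η(b) = unitSection` of `Modules/PullbackUnitSections`);
* §5 **`θ` is an ISOMORPHISM for `M`, `N` finite locally free** (`isIso_pullbackTensorHom`,
  `pullbackTensorIso f hM hN : f^*(M ⊗ N) ≅ f^*M ⊗ f^*N`, with `_hom_app_unitSection`,
  `_inv_app_tmulSection`, `_hom_naturality`): over a common frame neighbourhood `U` of `M`, `N`
  (`TensorProductLocallyFree.FramePair`), the pull-backs `η(b_i ⊗ c_j)` form a frame of `f^*(M ⊗ N)`
  over `f⁻¹U` (`frame_unitSection_bijective` — pull-backs of a frame form a frame, from the tree's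
  `pullbackFrame` — applied to the frame `b_i ⊗ c_j` of `M ⊗ N`, `DetClassTensor.frame_prod_tensorObj_bijective`)
  and the `η(b_i) ⊗ η(c_j)` form a frame of `f^*M ⊗ f^*N` (`FramePair.pullback`); `θ` carries the
  one to the other by §4, so it is bijective on sections over every `W ⊆ f⁻¹U`
  (`pullbackTensorHom_app_bijective_of_framePair`), and isomorphisms of `𝒪_X`-modules are local
  (`WittGEFramesLocal.isIso_of_nhds_bijective`).

Everything is proved; no named facts, no instances, no notation. Not here: the isomorphism for
ARBITRARY `𝒪_Y`-modules `M`, `N` (Stacks 01CA in full; needs the stalk formulas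
`(f^*𝓕)_x = 𝓕_{f(x)} ⊗ 𝒪_{X,x}`, `(𝓕 ⊗ 𝓖)_x = 𝓕_x ⊗ 𝓖_x`), the unit/associativity compatibilities
of `θ` (no associator for `tensorObj` in the tree), the projection formula. Use (Hodge programme, road
№4, crux 26512, library items (P1)/(M3b)/(g2): base change of external tensor products
`τ_{(x,y)}^*(E ⊠ F) ≅ τ_x^*E ⊠ τ_y^*F` and Mukai's exchange rows); library only — proves nothing about
26512, №4, HC_AV or HC.

## References

* The Stacks Project, Tag 01CA (Modules, §17.16; Lemma 17.16.4), Tag 01CE (7). [StacksProject]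
* U. Görtz, T. Wedhorn, *Algebraic Geometry I: Schemes*, 2nd ed. (2020), (7.8.2)–(7.8.3) (p. 182). [GortzWedhorn2020]
* R. Hartshorne, *Algebraic Geometry*, GTM 52 (1977), II.5 (p. 109–110: `f^*`, locally free sheaves). [Hartshorne1977]
-/

noncomputable section

-- `TopCat.Presheaf`/`Scheme.Modules` are not reducible (as in Mathlib's `AlgebraicGeometry/Modules/Sheaf.lean`).
set_option backward.isDefEq.respectTransparency false

open CategoryTheory AlgebraicGeometry Opposite TopologicalSpace MonoidalCategory
open scoped TensorProduct

universe u

namespace Literature.AlgebraicGeometry.Modules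

variable {X Y : Scheme.{u}} (f : X ⟶ Y)

/-! ### §1 Elementary tensors `s ⊗ t ∈ Γ(P ⊗ Q, U)` -/

section Tmul

variable (P Q : X.Modules)

/-- The elementary tensor `s ⊗ t ∈ Γ(P ⊗ Q, U)` of two sections over `U`: the image of `s ⊗ₜ t` under the
sheafification unit `P(U) ⊗_{𝒪_X(U)} Q(U) → (P ⊗ Q)(U)` (`tensorUnitHom`). [cite: StacksProject, Tag 01CA] -/
def tmulSection (U : X.Opens) (s : secMod P U) (t : secMod Q U) : secMod (tensorObj P Q) U :=
  (tensorUnitHom P Q).app (op U) (s ⊗ₜ[secRing X U] t)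

/-- Unfolding. [cite: StacksProject, Tag 01CA] -/
theorem tmulSection_def (U : X.Opens) (s : secMod P U) (t : secMod Q U) :
    tmulSection P Q U s t = (tensorUnitHom P Q).app (op U) (s ⊗ₜ[secRing X U] t) :=
  rfl

/-- `(s + s') ⊗ t = s ⊗ t + s' ⊗ t`. [cite: StacksProject, Tag 01CA] -/
theorem tmulSection_add_left (U : X.Opens) (s s' : secMod P U) (t : secMod Q U) :
    tmulSection P Q U (s + s') t = tmulSection P Q U s t + tmulSection P Q U s' t := by
  rw [tmulSection_def, TensorProduct.add_tmul, map_add]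
  rfl

/-- `s ⊗ (t + t') = s ⊗ t + s ⊗ t'`. [cite: StacksProject, Tag 01CA] -/
theorem tmulSection_add_right (U : X.Opens) (s : secMod P U) (t t' : secMod Q U) :
    tmulSection P Q U s (t + t') = tmulSection P Q U s t + tmulSection P Q U s t' := by
  rw [tmulSection_def, TensorProduct.tmul_add, map_add]
  rfl

/-- `(r s) ⊗ t = r (s ⊗ t)`. [cite: StacksProject, Tag 01CA] -/
theorem tmulSection_smul_left (U : X.Opens) (r : secRing X U) (s : secMod P U) (t : secMod Q U) :
    tmulSection P Q U (r • s) t = r • tmulSection P Q U s t := by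
  rw [tmulSection_def, tmulSection_def, ← TensorProduct.smul_tmul']
  exact tensorUnitHom_app_smul P Q U r _

/-- `s ⊗ (r t) = r (s ⊗ t)`. [cite: StacksProject, Tag 01CA] -/
theorem tmulSection_smul_right (U : X.Opens) (r : secRing X U) (s : secMod P U) (t : secMod Q U) :
    tmulSection P Q U s (r • t) = r • tmulSection P Q U s t := by
  rw [tmulSection_def, tmulSection_def, TensorProduct.tmul_smul]
  exact tensorUnitHom_app_smul P Q U r _

/-- Restriction of an elementary tensor along a morphism of (opposite) opens: `(s ⊗ t)|_V = s|_V ⊗ t|_V`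
(naturality of the sheafification unit, and `PresheafOfModules.Monoidal.tensorObj_map_tmul`).
[cite: StacksProject, Tag 01CA] -/
theorem val_map_tmulSection {U V : (X.Opens)ᵒᵖ} (g : U ⟶ V) (s : secMod P U.unop) (t : secMod Q U.unop) :
    (tensorObj P Q).val.map g (tmulSection P Q U.unop s t) =
      tmulSection P Q V.unop (P.val.map g s) (Q.val.map g t) := by
  rw [tmulSection_def, tmulSection_def]
  erw [← PresheafOfModules.naturality_apply (tensorUnitHom P Q) g]
  rfl

/-- Restriction of an elementary tensor: `(s ⊗ t)|_V = s|_V ⊗ t|_V`. [cite: StacksProject, Tag 01CA] -/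
theorem res_tmulSection {U V : X.Opens} (hV : V ≤ U) (s : secMod P U) (t : secMod Q U) :
    res (tensorObj P Q) hV (tmulSection P Q U s t) = tmulSection P Q V (res P hV s) (res Q hV t) :=
  val_map_tmulSection P Q (homOfLE hV).op s t

end Tmul

/-! ### §2 The lax structure `f_*P ⊗ f_*Q ⟶ f_*(P ⊗ Q)` of the direct image -/

section Lax

variable (P Q : X.Modules)

/-- The `𝒪_Y(V)`-bilinear map `(s, t) ↦ s ⊗ t`, `Γ(f_*P, V) × Γ(f_*Q, V) → Γ(f_*(P ⊗ Q), V)`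
(`Γ(f_*P, V) = Γ(P, f⁻¹V)` with `r · s = f♯(r) s`). [cite: StacksProject, Tag 01CA] -/
def pushforwardTensorBilin (V : Y.Opens) :
    secMod ((Scheme.Modules.pushforward f).obj P) V →ₗ[secRing Y V]
      secMod ((Scheme.Modules.pushforward f).obj Q) V →ₗ[secRing Y V]
        secMod ((Scheme.Modules.pushforward f).obj (tensorObj P Q)) V :=
  LinearMap.mk₂ (secRing Y V)
    (fun s t => (tmulSection P Q (f ⁻¹ᵁ V) s t : secMod (tensorObj P Q) (f ⁻¹ᵁ V)))
    (fun _ _ _ => tmulSection_add_left P Q _ _ _ _)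
    (fun r s t => tmulSection_smul_left P Q (f ⁻¹ᵁ V) (f.app V r) s t)
    (fun _ _ _ => tmulSection_add_right P Q _ _ _ _)
    (fun r s t => tmulSection_smul_right P Q (f ⁻¹ᵁ V) (f.app V r) s t)

/-- Its values: `pushforwardTensorBilin s t = s ⊗ t`. [cite: StacksProject, Tag 01CA] -/
theorem pushforwardTensorBilin_apply (V : Y.Opens) (s : secMod P (f ⁻¹ᵁ V)) (t : secMod Q (f ⁻¹ᵁ V)) :
    pushforwardTensorBilin f P Q V s t = tmulSection P Q (f ⁻¹ᵁ V) s t := rfl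

/-- The presheaf-level lax structure `f_*P ⊗_p f_*Q ⟶ f_*(P ⊗ Q)`: on `V`,
`P(f⁻¹V) ⊗_{𝒪_Y(V)} Q(f⁻¹V) → (P ⊗ Q)(f⁻¹V)`, `s ⊗ t ↦ s ⊗ t`. [cite: StacksProject, Tag 01CA] -/
def pushforwardTensorPre :
    tensorPresheaf ((Scheme.Modules.pushforward f).obj P) ((Scheme.Modules.pushforward f).obj Q) ⟶
      (Scheme.Modules.toPresheafOfModules Y).obj
        ((Scheme.Modules.pushforward f).obj (tensorObj P Q)) where
  app V := ModuleCat.ofHom (Y := secMod ((Scheme.Modules.pushforward f).obj (tensorObj P Q)) V.unop)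
    (TensorProduct.lift (pushforwardTensorBilin f P Q V.unop))
  naturality {V W} i := by
    apply ModuleCat.hom_ext
    apply TensorProduct.ext'
    intro s t
    exact (val_map_tmulSection P Q ((Opens.map f.base).op.map i) s t).symm

/-- On elementary tensors the presheaf-level lax structure is `s ⊗ₜ t ↦ s ⊗ t`. [cite: StacksProject, Tag 01CA] -/
theorem pushforwardTensorPre_app_tmul (V : Y.Opens) (s : secMod P (f ⁻¹ᵁ V)) (t : secMod Q (f ⁻¹ᵁ V)) :
    (pushforwardTensorPre f P Q).app (op V)
        ((s : secMod ((Scheme.Modules.pushforward f).obj P) V) ⊗ₜ[secRing Y V]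
          (t : secMod ((Scheme.Modules.pushforward f).obj Q) V)) =
      tmulSection P Q (f ⁻¹ᵁ V) s t :=
  TensorProduct.lift.tmul _ _

/-- **The lax structure of the direct image**, `f_*P ⊗ f_*Q ⟶ f_*(P ⊗ Q)`: the transpose of the
presheaf-level map across the sheafification adjunction (`modulesSheafifyAdjunction`).
[cite: StacksProject, Tag 01CA] -/
def pushforwardTensorHom :
    tensorObj ((Scheme.Modules.pushforward f).obj P) ((Scheme.Modules.pushforward f).obj Q) ⟶
      (Scheme.Modules.pushforward f).obj (tensorObj P Q) :=
  ((modulesSheafifyAdjunction Y).homEquiv _ _).symm (pushforwardTensorPre f P Q)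

/-- The lax structure on elementary tensors: `(η_U s) ⊗ (η_U t) ↦ …`; precisely, composed with the
sheafification unit it is the presheaf-level map. [cite: StacksProject, Tag 01CA] -/
theorem tensorUnitHom_comp_pushforwardTensorHom :
    tensorUnitHom ((Scheme.Modules.pushforward f).obj P) ((Scheme.Modules.pushforward f).obj Q) ≫
        (Scheme.Modules.toPresheafOfModules Y).map (pushforwardTensorHom f P Q) =
      pushforwardTensorPre f P Q := by
  unfold pushforwardTensorHom tensorUnitHom
  rw [← Adjunction.homEquiv_unit, Equiv.apply_symm_apply]

/-- **`μ(s ⊗ t) = s ⊗ t`**: on the elementary tensor of `s ∈ Γ(f_*P, V) = Γ(P, f⁻¹V)` and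
`t ∈ Γ(f_*Q, V)` the lax structure is the elementary tensor of `P ⊗ Q` over `f⁻¹V`.
[cite: StacksProject, Tag 01CA] -/
theorem pushforwardTensorHom_app_tmulSection (V : Y.Opens) (s : secMod P (f ⁻¹ᵁ V))
    (t : secMod Q (f ⁻¹ᵁ V)) :
    (pushforwardTensorHom f P Q).app V
        (tmulSection ((Scheme.Modules.pushforward f).obj P) ((Scheme.Modules.pushforward f).obj Q) V s t) =
      tmulSection P Q (f ⁻¹ᵁ V) s t := by
  have h := congrArg (fun φ => φ.app (op V)
    ((s : secMod ((Scheme.Modules.pushforward f).obj P) V) ⊗ₜ[secRing Y V]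
      (t : secMod ((Scheme.Modules.pushforward f).obj Q) V)))
    (tensorUnitHom_comp_pushforwardTensorHom f P Q)
  simp only [PresheafOfModules.comp_app] at h
  rw [pushforwardTensorPre_app_tmul] at h
  exact h

/-- **`(φ ⊗ ψ)(s ⊗ t) = φ(s) ⊗ ψ(t)`** on elementary tensors (naturality of the sheafification unit with
respect to the presheaf tensor product of morphisms). [cite: StacksProject, Tag 01CA] -/
theorem tensorMap_app_tmulSection {P P' Q Q' : X.Modules} (φ : P ⟶ P') (ψ : Q ⟶ Q') (U : X.Opens)
    (s : secMod P U) (t : secMod Q U) :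
    (tensorMap φ ψ).app U (tmulSection P Q U s t) = tmulSection P' Q' U (φ.app U s) (ψ.app U t) := by
  have h := congrArg (fun α => α.app (op U) (s ⊗ₜ[secRing X U] t))
    ((modulesSheafifyAdjunction X).unit.naturality
      (homToCommRingedPresheaf φ ⊗ₘ homToCommRingedPresheaf ψ : tensorPresheaf P Q ⟶ tensorPresheaf P' Q'))
  simp only [Functor.id_map, Functor.comp_map, PresheafOfModules.comp_app] at h
  exact h.symm

/-- **Naturality of the lax structure**: `(f_*φ ⊗ f_*ψ) ≫ μ = μ ≫ f_*(φ ⊗ ψ)`.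
[cite: StacksProject, Tag 01CA] -/
theorem pushforwardTensorHom_naturality {P P' Q Q' : X.Modules} (φ : P ⟶ P') (ψ : Q ⟶ Q') :
    tensorMap ((Scheme.Modules.pushforward f).map φ) ((Scheme.Modules.pushforward f).map ψ) ≫
        pushforwardTensorHom f P' Q' =
      pushforwardTensorHom f P Q ≫ (Scheme.Modules.pushforward f).map (tensorMap φ ψ) := by
  apply ((modulesSheafifyAdjunction Y).homEquiv _ _).injective
  rw [Adjunction.homEquiv_naturality_right, Adjunction.homEquiv_unit, Adjunction.homEquiv_unit,
    Functor.map_comp, ← Category.assoc]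
  unfold tensorMap
  rw [(modulesSheafifyAdjunction Y).unit_naturality, Category.assoc]
  change _ ≫ tensorUnitHom _ _ ≫ (Scheme.Modules.toPresheafOfModules Y).map (pushforwardTensorHom f P' Q') =
    (tensorUnitHom _ _ ≫ (Scheme.Modules.toPresheafOfModules Y).map (pushforwardTensorHom f P Q)) ≫ _
  rw [tensorUnitHom_comp_pushforwardTensorHom, tensorUnitHom_comp_pushforwardTensorHom]
  ext V : 1
  apply ModuleCat.hom_ext
  apply TensorProduct.ext'
  intro s t
  exact (tensorMap_app_tmulSection φ ψ (f ⁻¹ᵁ V.unop) s t).symm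

end Lax

/-! ### §3 The comparison `f^*(M ⊗ N) ⟶ f^*M ⊗ f^*N` -/

section Comparison

variable (M N : Y.Modules)

/-- The transpose `M ⊗ N ⟶ f_*(f^*M ⊗ f^*N)` of the comparison: `η_M ⊗ η_N` followed by the lax
structure of `f_*`. [cite: StacksProject, Tag 01CA] -/
def pullbackTensorTransposeHom :
    tensorObj M N ⟶ (Scheme.Modules.pushforward f).obj
      (tensorObj ((Scheme.Modules.pullback f).obj M) ((Scheme.Modules.pullback f).obj N)) :=
  tensorMap (pullbackUnit f M) (pullbackUnit f N) ≫
    pushforwardTensorHom f ((Scheme.Modules.pullback f).obj M) ((Scheme.Modules.pullback f).obj N)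

/-- Unfolding. [cite: StacksProject, Tag 01CA] -/
theorem pullbackTensorTransposeHom_def :
    pullbackTensorTransposeHom f M N = tensorMap (pullbackUnit f M) (pullbackUnit f N) ≫
      pushforwardTensorHom f ((Scheme.Modules.pullback f).obj M) ((Scheme.Modules.pullback f).obj N) :=
  rfl

/-- **The base-change morphism of the tensor product**, `f^*(M ⊗ N) ⟶ f^*M ⊗ f^*N`: the transpose across
`f^* ⊣ f_*` (Mathlib's `Scheme.Modules.pullbackPushforwardAdjunction`) of `M ⊗ N ⟶ f_*(f^*M ⊗ f^*N)`,
`m ⊗ n ↦ η(m) ⊗ η(n)`. (An isomorphism — Stacks 01CA, Lemma 17.16.4 `f^*(𝓕 ⊗ 𝓖) = f^*𝓕 ⊗ f^*𝓖`; the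
isomorphism half is not proved in this file.) [cite: StacksProject, Tag 01CA (Lemma 17.16.4)] -/
def pullbackTensorHom :
    (Scheme.Modules.pullback f).obj (tensorObj M N) ⟶
      tensorObj ((Scheme.Modules.pullback f).obj M) ((Scheme.Modules.pullback f).obj N) :=
  ((Scheme.Modules.pullbackPushforwardAdjunction f).homEquiv _ _).symm (pullbackTensorTransposeHom f M N)

/-- The comparison is `f^*(transpose) ≫ ε`. [cite: StacksProject, Tag 01CA] -/
theorem pullbackTensorHom_eq :
    pullbackTensorHom f M N = (Scheme.Modules.pullback f).map (pullbackTensorTransposeHom f M N) ≫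
      (Scheme.Modules.pullbackPushforwardAdjunction f).counit.app _ :=
  (Scheme.Modules.pullbackPushforwardAdjunction f).homEquiv_counit _ _ _

/-- The transpose of the comparison is `M ⊗ N ⟶ f_*(f^*M ⊗ f^*N)` (by construction).
[cite: StacksProject, Tag 01CA] -/
theorem homEquiv_pullbackTensorHom :
    (Scheme.Modules.pullbackPushforwardAdjunction f).homEquiv _ _ (pullbackTensorHom f M N) =
      pullbackTensorTransposeHom f M N :=
  Equiv.apply_symm_apply _ _

variable {M N} in
/-- **Naturality of the comparison** in both variables: for `α : M ⟶ M'`, `β : N ⟶ N'`,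
`f^*(α ⊗ β) ≫ θ_{M',N'} = θ_{M,N} ≫ (f^*α ⊗ f^*β)`. [cite: StacksProject, Tag 01CA] -/
theorem pullbackTensorHom_naturality {M' N' : Y.Modules} (α : M ⟶ M') (β : N ⟶ N') :
    (Scheme.Modules.pullback f).map (tensorMap α β) ≫ pullbackTensorHom f M' N' =
      pullbackTensorHom f M N ≫
        tensorMap ((Scheme.Modules.pullback f).map α) ((Scheme.Modules.pullback f).map β) := by
  apply ((Scheme.Modules.pullbackPushforwardAdjunction f).homEquiv _ _).injective
  rw [Adjunction.homEquiv_naturality_left, Adjunction.homEquiv_naturality_right, homEquiv_pullbackTensorHom,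
    homEquiv_pullbackTensorHom, pullbackTensorTransposeHom_def, pullbackTensorTransposeHom_def,
    Category.assoc, ← pushforwardTensorHom_naturality, ← Category.assoc, ← Category.assoc, ← tensorMap_comp,
    ← tensorMap_comp]
  congr 2
  · exact ((Scheme.Modules.pullbackPushforwardAdjunction f).unit_naturality α).symm
  · exact ((Scheme.Modules.pullbackPushforwardAdjunction f).unit_naturality β).symm

/-- Naturality in the first variable. [cite: StacksProject, Tag 01CA] -/
theorem pullbackTensorHom_naturality_left {M' : Y.Modules} (α : M ⟶ M') :
    (Scheme.Modules.pullback f).map (tensorMap α (𝟙 N)) ≫ pullbackTensorHom f M' N =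
      pullbackTensorHom f M N ≫ tensorMap ((Scheme.Modules.pullback f).map α) (𝟙 _) := by
  rw [pullbackTensorHom_naturality, CategoryTheory.Functor.map_id]

/-- Naturality in the second variable. [cite: StacksProject, Tag 01CA] -/
theorem pullbackTensorHom_naturality_right {N' : Y.Modules} (β : N ⟶ N') :
    (Scheme.Modules.pullback f).map (tensorMap (𝟙 M) β) ≫ pullbackTensorHom f M N' =
      pullbackTensorHom f M N ≫ tensorMap (𝟙 _) ((Scheme.Modules.pullback f).map β) := by
  rw [pullbackTensorHom_naturality, CategoryTheory.Functor.map_id]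

/-! ### §4 The value on pulled-back sections: `θ(η(m ⊗ n)) = η(m) ⊗ η(n)` -/

/-- The transpose on elementary tensors: `m ⊗ n ↦ η(m) ⊗ η(n)`. [cite: StacksProject, Tag 01CA] -/
theorem pullbackTensorTransposeHom_app_tmulSection (V : Y.Opens) (m : secMod M V) (n : secMod N V) :
    (pullbackTensorTransposeHom f M N).app V (tmulSection M N V m n) =
      tmulSection ((Scheme.Modules.pullback f).obj M) ((Scheme.Modules.pullback f).obj N) (f ⁻¹ᵁ V)
        (unitSection f M V m) (unitSection f N V n) := by
  rw [pullbackTensorTransposeHom_def, Scheme.Modules.Hom.comp_app, CategoryTheory.comp_apply,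
    tensorMap_app_tmulSection]
  exact pushforwardTensorHom_app_tmulSection f _ _ V _ _

/-- **`θ(η(m ⊗ n)) = η(m) ⊗ η(n)`**: on the pull-back of an elementary tensor the comparison
`f^*(M ⊗ N) ⟶ f^*M ⊗ f^*N` is the elementary tensor of the pulled-back sections. Since morphisms out of
`f^*(M ⊗ N)` over `f⁻¹V` are determined by their values on pulled-back sections
(`PullbackUnitSections.hom_ext_of_unitSection`), this characterises `θ`. [cite: StacksProject, Tag 01CA (Lemma 17.16.4)] -/
theorem pullbackTensorHom_app_unitSection (V : Y.Opens) (m : secMod M V) (n : secMod N V) :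
    (pullbackTensorHom f M N).app (f ⁻¹ᵁ V) (unitSection f (tensorObj M N) V (tmulSection M N V m n)) =
      tmulSection ((Scheme.Modules.pullback f).obj M) ((Scheme.Modules.pullback f).obj N) (f ⁻¹ᵁ V)
        (unitSection f M V m) (unitSection f N V n) := by
  rw [pullbackTensorHom_eq, Scheme.Modules.Hom.comp_app, CategoryTheory.comp_apply,
    pullback_map_app_unitSection, pullbackTensorTransposeHom_app_tmulSection]
  exact counit_app_unitSection f _ V _

end Comparison

/-! ### §5 The comparison is an isomorphism for finite locally free `M`, `N` -/

section Iso

open Literature.AlgebraicGeometry.FormalGeometry.WittGrothendieckExistence.FormalVectorBundlesAlgebraize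
open Literature.AlgebraicGeometry.Motives (IsFiniteLocallyFree)

variable {f}

/-- **The pull-backs `η(b_i)` of a frame `(b_i)` of `E` over `U` form a frame of `f^*E` over `f⁻¹U`**
(sections form: `a ↦ ∑ a_i η(b_i)|_W` is bijective for every `W ⊆ f⁻¹U`; the tree's `pullbackFrame`
with `basisSection_pullbackFrame`, transported through `exists_frame_basisSection_eq` /
`basisSection_frame_bijective`). [cite: Hartshorne1977, II.5 (p. 110)] -/
theorem frame_unitSection_bijective {E : Y.Modules} {U : Y.Opens} {I : Type u} [Fintype I]
    (b : I → Γ(E, U))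
    (hb : ∀ (V : Y.Opens) (hV : V ≤ U), Function.Bijective fun a : I → Γ(Y, V) =>
      ∑ i, a i • E.presheaf.map (homOfLE hV).op (b i))
    (W : X.Opens) (hW : W ≤ f ⁻¹ᵁ U) :
    Function.Bijective fun a : I → Γ(X, W) =>
      ∑ i, a i • ((Scheme.Modules.pullback f).obj E).presheaf.map (homOfLE hW).op
        (unitSection f E U (b i)) := by
  obtain ⟨e₁⟩ := PushforwardTransport.nonempty_freeIso_restrict_of_frame E U b hb
  obtain ⟨e₀⟩ := Literature.AlgebraicGeometry.KTheory.nonempty_overIso_of_restrictIso e₁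
  have hbU : Function.Bijective fun a : I → Γ(Y, U) => ∑ i, a i • b i := by
    have h := hb U le_rfl
    have hid : ∀ i, E.presheaf.map (homOfLE (le_refl U)).op (b i) = b i :=
      fun i => presheaf_map_id E _
    simp_rw [hid] at h
    exact h
  obtain ⟨e, he⟩ := exists_frame_basisSection_eq e₀ b hbU
  have h := basisSection_frame_bijective (pullbackFrame f e) (homOfLE hW)
  have hb' : ∀ i, basisSection (E := (Scheme.Modules.pullback f).obj E) (pullbackFrame f e) i =
      unitSection f E U (b i) := fun i => by rw [basisSection_pullbackFrame, he]
  simp_rw [hb'] at h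
  exact h

/-- **The pulled-back frame pair** of `(f^*M, f^*N)` over `f⁻¹U`: the sections `η(b_i)`, `η(c_j)`.
[cite: Hartshorne1977, II.5 (p. 110)] -/
def FramePair.pullback {M N : Y.Modules} {U : Y.Opens} {I K : Type u} [Fintype I] [Fintype K]
    (F : FramePair M N U I K) :
    FramePair ((Scheme.Modules.pullback f).obj M) ((Scheme.Modules.pullback f).obj N) (f ⁻¹ᵁ U) I K where
  b i := unitSection f M U (F.b i)
  c j := unitSection f N U (F.c j)
  hb := frame_unitSection_bijective F.b F.hb
  hc := frame_unitSection_bijective F.c F.hc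

/-- The sections of the pulled-back frame pair (by construction). [cite: Hartshorne1977, II.5 (p. 110)] -/
theorem FramePair.pullback_b {M N : Y.Modules} {U : Y.Opens} {I K : Type u} [Fintype I] [Fintype K]
    (F : FramePair M N U I K) (i : I) : (F.pullback (f := f)).b i = unitSection f M U (F.b i) := rfl

/-- The sections of the pulled-back frame pair (by construction). [cite: Hartshorne1977, II.5 (p. 110)] -/
theorem FramePair.pullback_c {M N : Y.Modules} {U : Y.Opens} {I K : Type u} [Fintype I] [Fintype K]
    (F : FramePair M N U I K) (j : K) : (F.pullback (f := f)).c j = unitSection f N U (F.c j) := rfl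

/-- **Over a common frame neighbourhood the comparison is bijective on sections**: for a frame pair
`(b, c)` of `(M, N)` over `U` and `W ⊆ f⁻¹U`, `θ_W : Γ(f^*(M ⊗ N), W) → Γ(f^*M ⊗ f^*N, W)` carries the
frame `η(b_i ⊗ c_j)|_W` to the frame `(η(b_i) ⊗ η(c_j))|_W` (§4), hence is bijective.
[cite: StacksProject, Tag 01CA (Lemma 17.16.4)] -/
theorem pullbackTensorHom_app_bijective_of_framePair {M N : Y.Modules} {U : Y.Opens} {I K : Type u}
    [Fintype I] [Fintype K] (F : FramePair M N U I K) (W : X.Opens) (hW : W ≤ f ⁻¹ᵁ U) :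
    Function.Bijective ((pullbackTensorHom f M N).app W) := by
  -- the frame `η(b_i ⊗ c_j)` of `f^*(M ⊗ N)` over `f⁻¹U`
  have hS := frame_unitSection_bijective (f := f) (E := tensorObj M N) (U := U)
    (fun p => (tensorUnitHom M N).app (op U) (F.basis U le_rfl p))
    (frame_prod_tensorObj_bijective M N F) W hW
  -- the frame `η(b_i) ⊗ η(c_j)` of `f^*M ⊗ f^*N` over `f⁻¹U`
  have hT := frame_prod_tensorObj_bijective _ _ (F.pullback (f := f)) W hW
  have key : (fun a : I × K → Γ(X, W) => ∑ p, a p •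
      (tensorObj ((Scheme.Modules.pullback f).obj M) ((Scheme.Modules.pullback f).obj N)).presheaf.map
        (homOfLE hW).op ((tensorUnitHom ((Scheme.Modules.pullback f).obj M)
          ((Scheme.Modules.pullback f).obj N)).app (op (f ⁻¹ᵁ U))
            ((F.pullback (f := f)).basis (f ⁻¹ᵁ U) le_rfl p))) =
      (pullbackTensorHom f M N).app W ∘ fun a : I × K → Γ(X, W) => ∑ p, a p •
        ((Scheme.Modules.pullback f).obj (tensorObj M N)).presheaf.map (homOfLE hW).op
          (unitSection f (tensorObj M N) U
            ((tensorUnitHom M N).app (op U) (F.basis U le_rfl p) : Γ(tensorObj M N, U))) := by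
    funext a
    simp only [Function.comp_apply, map_sum, Scheme.Modules.Hom.app_smul]
    refine Finset.sum_congr rfl fun p _ => ?_
    congr 1
    rw [app_presheaf_map (pullbackTensorHom f M N) (homOfLE hW)]
    congr 1
    rw [F.basis_apply, (F.pullback (f := f)).basis_apply, FramePair.pullback_b, FramePair.pullback_c]
    have h1 : res M (le_refl U) (F.b p.1) = F.b p.1 := presheaf_map_id M _
    have h2 : res N (le_refl U) (F.c p.2) = F.c p.2 := presheaf_map_id N _
    have h3 : res ((Scheme.Modules.pullback f).obj M) (le_refl (f ⁻¹ᵁ U)) (unitSection f M U (F.b p.1)) =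
        unitSection f M U (F.b p.1) := presheaf_map_id _ _
    have h4 : res ((Scheme.Modules.pullback f).obj N) (le_refl (f ⁻¹ᵁ U)) (unitSection f N U (F.c p.2)) =
        unitSection f N U (F.c p.2) := presheaf_map_id _ _
    rw [h1, h2, h3, h4]
    exact (pullbackTensorHom_app_unitSection f M N U (F.b p.1) (F.c p.2)).symm
  rw [key] at hT
  exact (Function.Bijective.of_comp_iff _ hS).mp hT

variable (f) {M N : Y.Modules}

/-- **`f^*(M ⊗ N) ⟶ f^*M ⊗ f^*N` is an isomorphism for `M`, `N` finite locally free** (Stacks 01CA,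
Lemma 17.16.4, in the locally free case): bijective on sections over every open below a common frame
neighbourhood (`pullbackTensorHom_app_bijective_of_framePair`), and isomorphisms of `𝒪_X`-modules are
local (`isIso_of_nhds_bijective`). [cite: StacksProject, Tag 01CA (Lemma 17.16.4)] -/
theorem isIso_pullbackTensorHom (hM : IsFiniteLocallyFree M) (hN : IsFiniteLocallyFree N) :
    IsIso (pullbackTensorHom f M N) := by
  refine PushforwardTransport.isIso_of_nhds_bijective _ fun x => ?_
  obtain ⟨U, hxU, I, K, _, _, ⟨F⟩⟩ := exists_framePair M N hM hN (f.base x)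
  exact ⟨f ⁻¹ᵁ U, hxU, fun W hW => pullbackTensorHom_app_bijective_of_framePair F W hW⟩

/-- **`f^*(M ⊗ N) ≅ f^*M ⊗ f^*N`** for finite locally free `M`, `N` (pull-back is monoidal on
vector bundles). [cite: StacksProject, Tag 01CA (Lemma 17.16.4)] -/
def pullbackTensorIso (hM : IsFiniteLocallyFree M) (hN : IsFiniteLocallyFree N) :
    (Scheme.Modules.pullback f).obj (tensorObj M N) ≅
      tensorObj ((Scheme.Modules.pullback f).obj M) ((Scheme.Modules.pullback f).obj N) :=
  haveI := isIso_pullbackTensorHom f hM hN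
  asIso (pullbackTensorHom f M N)

/-- The isomorphism is the comparison morphism. [cite: StacksProject, Tag 01CA (Lemma 17.16.4)] -/
@[simp]
theorem pullbackTensorIso_hom (hM : IsFiniteLocallyFree M) (hN : IsFiniteLocallyFree N) :
    (pullbackTensorIso f hM hN).hom = pullbackTensorHom f M N := rfl

/-- On pulled-back elementary tensors the isomorphism is `η(m ⊗ n) ↦ η(m) ⊗ η(n)`.
[cite: StacksProject, Tag 01CA (Lemma 17.16.4)] -/
theorem pullbackTensorIso_hom_app_unitSection (hM : IsFiniteLocallyFree M) (hN : IsFiniteLocallyFree N)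
    (V : Y.Opens) (m : secMod M V) (n : secMod N V) :
    (pullbackTensorIso f hM hN).hom.app (f ⁻¹ᵁ V) (unitSection f (tensorObj M N) V (tmulSection M N V m n)) =
      tmulSection ((Scheme.Modules.pullback f).obj M) ((Scheme.Modules.pullback f).obj N) (f ⁻¹ᵁ V)
        (unitSection f M V m) (unitSection f N V n) :=
  pullbackTensorHom_app_unitSection f M N V m n

/-- … and the inverse is `η(m) ⊗ η(n) ↦ η(m ⊗ n)`. [cite: StacksProject, Tag 01CA (Lemma 17.16.4)] -/
theorem pullbackTensorIso_inv_app_tmulSection (hM : IsFiniteLocallyFree M) (hN : IsFiniteLocallyFree N)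
    (V : Y.Opens) (m : secMod M V) (n : secMod N V) :
    (pullbackTensorIso f hM hN).inv.app (f ⁻¹ᵁ V)
        (tmulSection ((Scheme.Modules.pullback f).obj M) ((Scheme.Modules.pullback f).obj N) (f ⁻¹ᵁ V)
          (unitSection f M V m) (unitSection f N V n)) =
      unitSection f (tensorObj M N) V (tmulSection M N V m n) := by
  rw [← pullbackTensorIso_hom_app_unitSection f hM hN V m n, ← CategoryTheory.comp_apply,
    ← Scheme.Modules.Hom.comp_app, Iso.hom_inv_id, Scheme.Modules.Hom.id_app]
  rfl

/-- Naturality of the isomorphism (from `pullbackTensorHom_naturality`).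
[cite: StacksProject, Tag 01CA (Lemma 17.16.4)] -/
theorem pullbackTensorIso_hom_naturality {M' N' : Y.Modules} (hM : IsFiniteLocallyFree M)
    (hN : IsFiniteLocallyFree N) (hM' : IsFiniteLocallyFree M') (hN' : IsFiniteLocallyFree N')
    (α : M ⟶ M') (β : N ⟶ N') :
    (Scheme.Modules.pullback f).map (tensorMap α β) ≫ (pullbackTensorIso f hM' hN').hom =
      (pullbackTensorIso f hM hN).hom ≫
        tensorMap ((Scheme.Modules.pullback f).map α) ((Scheme.Modules.pullback f).map β) :=
  pullbackTensorHom_naturality f α β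

end Iso

end Literature.AlgebraicGeometry.Modules

end
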